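import Summits.HubbardSuperconductivity.HubbardSuperconductivity.Theorems.AnisotropyChordInsertionEntropyStructureFactor
import Mathlib.Analysis.InnerProductSpace.PiL2
import Mathlib.Analysis.InnerProductSpace.Orthonormal

/-!
# Route `AnisotropyChord` / H0 rotor rung: the infrared input in STIFFNESS currency — Bessel, the WINDOW
# LEMMA, and THEOREM IR-S (theory seat cycle 8, memo ROTOR-THEORY-8 §103; Sketch8 Parts A–C ported)

PORT-SPEC P-10 of the theory seat `hubbard-h0-rotor-theory-1` (cycle 8).  Definition-free layer:

* `bessel_dotProduct` — Bessel's inequality for a finite orthonormal family of vectors `n → ℂ` in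
  `dotProduct` currency (transported from `Orthonormal.sum_inner_products_le` on `EuclideanSpace ℂ n`);
* `window_lemma` — for orthonormal `H`-eigenpairs `(vᵢ, λᵢ)` in the window `E < λᵢ ≤ E + Ω`:
  `Σᵢ |vᵢ†(Hx − Ex)|²/(λᵢ − E) ≤ Ω ‖x‖²` (the one-line heart of THEOREM IR-S);
* `sum_norm_sq_densityMode_mulVec` — `‖ρ_k a‖² = S_a(k) · P` for the diagonal density-mode operator
  `ρ_k = diagonal(σ ↦ Σ_{s : σ s = 0} e^{2πi k·s/L})` and the tree's `structureFactor`;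
* `comm_mulVec_eigen` — `[H, ρ_k] a = H(ρ_k a) − E(ρ_k a)` on an eigenvector;
* **THEOREM IR-S** `currentDiv_window_le_structureFactor` — the `1/(λ−E)`-weighted weight of the current
  divergence `D_k a = [H, ρ_k] a` in the window `(E, E + Ω]` is at most `Ω · S_a(k) · P`
  (lattice continuity equation: this is `S(k) ≥ ε(k) Υ^L_Ω(k)/(ρ Ω)` with the SCALE-RESOLVED longitudinal
  stiffness, memo §103).

The typed hypotheses (S_Ω), (S_Ω^γ), (S), (S_tw), L1 and the target TWIST-IR, with their proved links,
are in `AnisotropyChordStiffnessDefs`.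
-/

set_option linter.dupNamespace false

noncomputable section

open Matrix Complex Finset Filter Topology
open scoped ComplexConjugate Real
open Literature.MathematicalPhysics.QuantumLattice hiding torusPhase torusNorm
open Literature.Probability.LatticeModels
open Summit.HubbardSuperconductivity.HubbardSuperconductivity.Theorems.AnisotropyChord.InsertionEntropy

namespace Summit.HubbardSuperconductivity.HubbardSuperconductivity.Theorems.AnisotropyChord.Stiffness

/-! ## Part A — Bessel and the window lemma in `dotProduct` currency -/

section Abstract

variable {n ι : Type*} [Fintype n] [DecidableEq ι]

/-- **Bessel's inequality** for a finite orthonormal family of vectors `n → ℂ`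
(`vᵢ† vⱼ = δᵢⱼ` in `dotProduct` currency): `Σ_{i∈s} |vᵢ† x|² ≤ Σ_σ |x σ|²`.  (Transported from
`Orthonormal.sum_inner_products_le` on `EuclideanSpace ℂ n`; theory seat Sketch8 Part A.) [folklore] -/
theorem bessel_dotProduct (s : Finset ι) (v : ι → n → ℂ)
    (hv : ∀ i j, star (v i) ⬝ᵥ v j = if i = j then (1 : ℂ) else 0) (x : n → ℂ) :
    ∑ i ∈ s, ‖star (v i) ⬝ᵥ x‖ ^ 2 ≤ ∑ σ, ‖x σ‖ ^ 2 := by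
  let w : ι → EuclideanSpace ℂ n := fun i => WithLp.toLp 2 (v i)
  have hw : Orthonormal ℂ w := by
    rw [orthonormal_iff_ite]
    intro i j
    change inner ℂ (WithLp.toLp 2 (v i)) (WithLp.toLp 2 (v j)) = _
    rw [EuclideanSpace.inner_toLp_toLp, dotProduct_comm]
    exact hv i j
  have hB := hw.sum_inner_products_le (WithLp.toLp 2 x) (s := s)
  have h1 : ∀ i, inner ℂ (w i) (WithLp.toLp 2 x) = star (v i) ⬝ᵥ x := by
    intro i
    change inner ℂ (WithLp.toLp 2 (v i)) (WithLp.toLp 2 x) = _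
    rw [EuclideanSpace.inner_toLp_toLp, dotProduct_comm]
  have h2 : ‖(WithLp.toLp 2 x : EuclideanSpace ℂ n)‖ ^ 2 = ∑ σ, ‖x σ‖ ^ 2 := by
    rw [EuclideanSpace.norm_sq_eq]
  simpa [h1, h2] using hB

/-- **WINDOW LEMMA** (memo ROTOR-THEORY-8 §103).  `H` Hermitian, `E : ℝ`, `(vᵢ, λᵢ)_{i∈s}` orthonormal
`H`-eigenpairs with `E < λᵢ ≤ E + Ω`.  Then for every vector `x`,
`Σ_{i∈s} |vᵢ†(Hx − Ex)|²/(λᵢ − E) ≤ Ω · Σ_σ |x σ|²`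
(`vᵢ†(Hx − Ex) = (λᵢ − E) vᵢ† x`, so the summand is `(λᵢ−E)|vᵢ†x|² ≤ Ω|vᵢ†x|²`; Bessel). [folklore] -/
theorem window_lemma (s : Finset ι) (H : Matrix n n ℂ) (hH : H.IsHermitian)
    (E : ℝ) (v : ι → n → ℂ) (hv : ∀ i j, star (v i) ⬝ᵥ v j = if i = j then (1 : ℂ) else 0)
    (lam : ι → ℝ) (heig : ∀ i ∈ s, H *ᵥ v i = ((lam i : ℝ) : ℂ) • v i)
    (Ω : ℝ) (hΩ : 0 ≤ Ω) (hwin : ∀ i ∈ s, E < lam i ∧ lam i ≤ E + Ω) (x : n → ℂ) :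
    ∑ i ∈ s, ‖star (v i) ⬝ᵥ (H *ᵥ x - (E : ℂ) • x)‖ ^ 2 / (lam i - E)
      ≤ Ω * ∑ σ, ‖x σ‖ ^ 2 := by
  have key : ∀ i ∈ s, star (v i) ⬝ᵥ (H *ᵥ x - (E : ℂ) • x)
      = ((lam i - E : ℝ) : ℂ) * (star (v i) ⬝ᵥ x) := by
    intro i hi
    have h1 : star (v i) ⬝ᵥ (H *ᵥ x) = ((lam i : ℝ) : ℂ) * (star (v i) ⬝ᵥ x) := by
      rw [dotProduct_mulVec]
      have : star (v i) ᵥ* H = ((lam i : ℝ) : ℂ) • star (v i) := by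
        have h2 : star (H *ᵥ v i) = star (v i) ᵥ* H := by
          rw [star_mulVec, hH.eq]
        rw [← h2, heig i hi, star_smul]
        simp
      rw [this, smul_dotProduct, smul_eq_mul]
    rw [dotProduct_sub, dotProduct_smul, h1, smul_eq_mul]
    push_cast
    ring
  have hterm : ∀ i ∈ s, ‖star (v i) ⬝ᵥ (H *ᵥ x - (E : ℂ) • x)‖ ^ 2 / (lam i - E)
      ≤ Ω * ‖star (v i) ⬝ᵥ x‖ ^ 2 := by
    intro i hi
    have hgap : 0 < lam i - E := by linarith [(hwin i hi).1]
    have hle : lam i - E ≤ Ω := by linarith [(hwin i hi).2]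
    rw [key i hi, norm_mul, mul_pow, Complex.norm_real, Real.norm_eq_abs, abs_of_pos hgap,
      div_le_iff₀ hgap]
    have h0 : 0 ≤ ‖star (v i) ⬝ᵥ x‖ ^ 2 := by positivity
    nlinarith [mul_nonneg h0 hgap.le, hle]
  calc ∑ i ∈ s, ‖star (v i) ⬝ᵥ (H *ᵥ x - (E : ℂ) • x)‖ ^ 2 / (lam i - E)
      ≤ ∑ i ∈ s, Ω * ‖star (v i) ⬝ᵥ x‖ ^ 2 := Finset.sum_le_sum hterm
    _ = Ω * ∑ i ∈ s, ‖star (v i) ⬝ᵥ x‖ ^ 2 := by rw [Finset.mul_sum]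
    _ ≤ Ω * ∑ σ, ‖x σ‖ ^ 2 := mul_le_mul_of_nonneg_left (bessel_dotProduct s v hv x) hΩ

/-- On an eigenvector `x` of `H` (`Hx = Ex`) the commutator acts as `[H, D] x = H(Dx) − E(Dx)`. [folklore] -/
theorem comm_mulVec_eigen (H D : Matrix n n ℂ) (x : n → ℂ) (E : ℂ) (hx : H *ᵥ x = E • x) :
    (H * D - D * H) *ᵥ x = H *ᵥ (D *ᵥ x) - E • (D *ᵥ x) := by
  rw [sub_mulVec, ← mulVec_mulVec, ← mulVec_mulVec, hx, mulVec_smul]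

end Abstract

/-! ## Parts B–C — the density-mode operator and THEOREM IR-S on the torus -/

section Lattice

variable {L : ℕ} [NeZero L]

/-- `‖ρ_k a‖² = S_a(k) · P` for the diagonal density-mode operator and a real amplitude `a` (`P ≠ 0`). [folklore] -/
theorem sum_norm_sq_densityMode_mulVec (a : TensorIndex (TorusSite 2 L) 2 → ℝ) {P : ℝ} (hP : P ≠ 0)
    (k : TorusSite 2 L) :
    ∑ σ, ‖(Matrix.diagonal (fun σ : TensorIndex (TorusSite 2 L) 2 =>
        ∑ s, if σ s = 0 then torusPhase L k s else 0) *ᵥ (fun σ => (a σ : ℂ))) σ‖ ^ 2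
      = structureFactor L a P k * P := by
  rw [structureFactor_mul a hP k]
  refine Finset.sum_congr rfl fun σ _ => ?_
  rw [mulVec_diagonal, norm_mul, mul_pow, Complex.norm_real, Real.norm_eq_abs, sq_abs, mul_comm]

/-- **THEOREM IR-S** (theory seat memo ROTOR-THEORY-8 §103; Sketch8 Part C).  Let `a` be a real
eigenvector of the hard-core boson / XXZ torus Hamiltonian `H = xxzHamiltonian 1 (torusGraph 2 L) (−1) Δ`
with eigenvalue `E`, `(vᵢ, λᵢ)_{i∈s}` orthonormal eigenpairs in the spectral window `E < λᵢ ≤ E + Ω`, and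
`P ≠ 0`.  Then the window-resolved inverse moment of the CURRENT DIVERGENCE `D_k a = [H, ρ_k] a` is
controlled by the static structure factor: `Σ_{i∈s} |vᵢ† D_k a|²/(λᵢ − E) ≤ Ω · S_a(k) · P`.
Read with the continuity equation (`D_k = Σᵢ (1 − e^{2πi kᵢ/L}) Jⁱ_k`) this is
`S(k) ≥ ε(k) Υ^L_Ω(k)/(ρ Ω)` with the scale-resolved longitudinal stiffness `Υ^L_Ω`. [folklore] -/
theorem currentDiv_window_le_structureFactor {ι : Type*} [DecidableEq ι] (s : Finset ι) (Δ : ℝ)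
    (a : TensorIndex (TorusSite 2 L) 2 → ℝ) (E : ℝ)
    (ha : xxzHamiltonian 1 (torusGraph 2 L) (-1) Δ *ᵥ (fun σ => (a σ : ℂ)) = (E : ℂ) • fun σ => (a σ : ℂ))
    (v : ι → TensorIndex (TorusSite 2 L) 2 → ℂ)
    (hv : ∀ i j, star (v i) ⬝ᵥ v j = if i = j then (1 : ℂ) else 0) (lam : ι → ℝ)
    (heig : ∀ i ∈ s, xxzHamiltonian 1 (torusGraph 2 L) (-1) Δ *ᵥ v i = ((lam i : ℝ) : ℂ) • v i)
    (Ω : ℝ) (hΩ : 0 ≤ Ω) (hwin : ∀ i ∈ s, E < lam i ∧ lam i ≤ E + Ω)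
    (P : ℝ) (hP : P ≠ 0) (k : TorusSite 2 L) :
    ∑ i ∈ s, ‖star (v i) ⬝ᵥ
        ((xxzHamiltonian 1 (torusGraph 2 L) (-1) Δ
            * Matrix.diagonal (fun σ : TensorIndex (TorusSite 2 L) 2 =>
                ∑ s, if σ s = 0 then torusPhase L k s else 0)
          - Matrix.diagonal (fun σ : TensorIndex (TorusSite 2 L) 2 =>
                ∑ s, if σ s = 0 then torusPhase L k s else 0)
            * xxzHamiltonian 1 (torusGraph 2 L) (-1) Δ) *ᵥ (fun σ => (a σ : ℂ)))‖ ^ 2 / (lam i - E)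
      ≤ Ω * (structureFactor L a P k * P) := by
  rw [comm_mulVec_eigen _ _ _ _ ha, ← sum_norm_sq_densityMode_mulVec a hP k]
  exact window_lemma s _ (xxzHamiltonian_isHermitian 1 (torusGraph 2 L) (-1) Δ) E v hv lam heig Ω hΩ
    hwin _

end Lattice

end Summit.HubbardSuperconductivity.HubbardSuperconductivity.Theorems.AnisotropyChord.Stiffness
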